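import Mathlib
import Summits.NavierStokesRegularity.NavierStokesRegularity.Theorems.TaoLadderRungThreeDyadicGapCertificateExactBlowup
import Summits.NavierStokesRegularity.NavierStokesRegularity.Theses.TaoLadderRungTwo
import HarnessLib

/-!
# What the comparable gap certificates prove BY THEMSELVES: the exact slice of the rung-2 target
  (helper for item stmt-NavierStokesRegularity-20500, crux K_A′ `ComparableGapCertificates` of route
  TaoLadderRungTwo)

HONEST FRAMING: a structural corollary about Tao-type MODEL lattice flows (Tao 2016, §4/§6 cascade
class, cell vocabulary). It is an IMPLICATION from the (open, predicted-false) crux K_A′; nothing is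
exhibited and nothing here is a statement about the Navier–Stokes equations.

**Statement.** `ComparableGapCertificates` implies the EXACT (inviscid, defect-free, `K₁ = K₂ = 0`)
slice of the rung target `TaoLadderRungTwo.Target`: for some spread `R ≥ 1` and threshold
`εs ∈ (0,1)`, every scale ratio `ε₀ ∈ (0, εs]` has a table `α ∈ InTableClass R` and a one-shell datum
`X₀` with `NoGlobalExactCascade ε₀ α X₀` — by `GapDataExact.noGlobalExactCascade_of_gapData`
(a gap certificate proves exact-class blow-up of its own table). The rung target itself asks for
`NoGlobalCascade` (every defect level), for which the perturbation crux K_B is needed in addition.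
Read contrapositively: a Liouville / global-existence theorem for EXACT comparable cascades at small
`ε₀` already refutes K_A′.
-/

noncomputable section

-- the sub-problem namespace `Summit.NavierStokesRegularity.NavierStokesRegularity` repeats the summit name by design (D-0017)
set_option linter.dupNamespace false

namespace Summit.NavierStokesRegularity.NavierStokesRegularity.Theorems

open Literature.Analysis.FluidPDE Literature.Analysis.FluidPDE.TaoCascade

open Summit.NavierStokesRegularity.NavierStokesRegularity.Theses.TaoLadderRungTwo in
/-- **K_A′ alone gives the exact slice of the rung-2 target**: `ComparableGapCertificates` ⇒ for some
`R ≥ 1`, `εs ∈ (0,1)` and every `ε₀ ∈ (0, εs]`, some `α ∈ InTableClass R`, `X₀` with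
`NoGlobalExactCascade ε₀ α X₀`. [cite: Tao2016AveragedNS, §4 Thm. 4.2 and (4.12); cell vocabulary] -/
theorem taoLadderRungTwo_exactBlowup_of_comparableGapCertificates (hA : ComparableGapCertificates) :
    ∃ R : ℝ, 1 ≤ R ∧ ∃ εs : ℝ, 0 < εs ∧ εs < 1 ∧ ∀ ε₀ : ℝ, 0 < ε₀ → ε₀ ≤ εs →
      ∃ (α : Fin 4 → Fin 4 → Fin 4 → ℤ × ℤ × ℤ → ℝ) (X₀ : Fin 4 → ℝ),
        InTableClass R α ∧ NoGlobalExactCascade ε₀ α X₀ := by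
  obtain ⟨R, hR, εs, hεs0, hεs1, hall⟩ := hA
  refine ⟨R, hR, εs, hεs0, hεs1, fun ε₀ hε₀ hε₀s => ?_⟩
  obtain ⟨i₀, α, X₀, Z, w, r, ρ, θ₀, θ, c₀, c, env₀, hα, hX₀, hgap⟩ := hall ε₀ hε₀ hε₀s
  exact ⟨α, X₀, hα, GapDataExact.noGlobalExactCascade_of_gapData hε₀ hX₀ hgap⟩

end Summit.NavierStokesRegularity.NavierStokesRegularity.Theorems

end
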